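import Literature.AlgebraicGeometry.HodgeTheory.CompleteIntersectionHodgeLocusCodim
import Literature.AlgebraicGeometry.DuqueFrancoVillaflor2025.JoinHilbertFunction
import HarnessLib

/-!
# Zero-dimensional fake linear cycles (Duque Franco–Villaflor 2025, Thm. 7.1) — algebraic core

Certified instances and evidence bearing on the general Hodge conjecture; no claim.

J. Duque Franco, R. Villaflor Loyola, *Periods of join algebraic cycles*, Ann. Sc. Norm. Super. Pisa (2025)
= arXiv:2312.17222 [DuqueFrancoVillaflor2025Join], §7 (held text pp. 18–19). **Definition 7.1**: for a smooth
hypersurface `X = {F = 0}` of even dimension `n` and an `n/2`-dimensional subvariety `Z ⊆ X`, a Hodge cycle `λ`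
is a *fake version of `[Z]`* if `HF_λ = HF_{[Z]}` but `λ_prim` is not a scalar multiple of `[Z]_prim`.
**Theorem 7.1**, verbatim: "Let `X = {F(x_0,x_1) := (x_0 − r_1x_1)(x_0 − r_2x_1)⋯(x_0 − r_dx_1) = 0} ⊆ ℙ¹` be a
smooth degree `d` hypersurface with `r_i ∈ ℚ` for all `i = 1,…,d`. Consider for each `c ∈ ℚ ∖ {r_1,…,r_d}` the
polynomial `P := (a ∂F/∂x_0 − b ∂F/∂x_1)/(x_0 − cx_1) ∈ R^F_{d−2}` for `a = ∂F/∂x_1(c,1)` and `b = ∂F/∂x_0(c,1)`.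
Then `δ := res(P·(x_0dx_1 − x_1dx_0)/F) ∈ H⁰(X,ℚ)_prim` is a `0`-dimensional fake linear cycle." Proof (p. 19):
each point class is a residue, `[p_i]_prim = (−1/d)·res(P_i·(x_0dx_1 − x_1dx_0)/F)` with
`P_i = (r_i ∂F/∂x_0 + ∂F/∂x_1)/(x_0 − r_ix_1) ∈ ℚ[x_0,x_1]_{d−2}` (eq. (eqPi)); `P ∈ ℚ[x_0,x_1]_{d−2}` is a
`ℚ`-combination of the `P_i`, so `δ` is rational; "To see that it defines a fake linear cycle it is enough to
see that `J^{F,δ} = (J^F : P) = ⟨x_0 − cx_1, x_0^{d−1}, x_1^{d−1}⟩` and so `HF_δ = HF_{[p_i]}`."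

## What this file PROVES (0 facts, 0 sorry), over any field `K`

Everything at the level of the polynomials `P`, `P_i` and the Jacobian ideal `J^F = ⟨F_{x₀}, F_{x₁}⟩`
(tree `Motives.UniversalHypersurface.jacobianIdeal`), with the Artinian–Gorenstein / colon-ideal / Hilbert-function
vocabulary of `DuqueFrancoVillaflor2025.IsArtinianGorenstein` (Def. 2.1), as in the sibling files of this
directory; the residue dictionary `P ↦ res(P·Ω/F)`, `(J^F : P_λ) = J^{F,λ}` is cited, not formalised.

* For ANY binary form `F` of degree `d ≥ 2` whose Jacobian ideal is Artinian Gorenstein of socle `2(d−2)`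
  (every form without multiple roots: tree `HodgeTheory.isArtinianGorenstein_jacobianIdeal_of_forall_aeval`),
  any `c ∈ K` at which `F_{x₀}`, `F_{x₁}` do not both vanish (automatic if `d·F(c,1) ≠ 0`, by Euler:
  `eval_pderiv_ne_zero_of_eval_ne_zero`), and any form `P ≠ 0` of degree `d − 2` with `P·(x₀ − c x₁) ∈ J^F`:
  **`(J^F : P) = ⟨x₀ − c x₁, x₁^{d−1}⟩ = ⟨x₀ − c x₁, x₀^{d−1}, x₁^{d−1}⟩`** (`jacobianIdeal_colon_eq_pointIdeal`,
  `…_eq_span_three`) and its Hilbert function is `pointHF d = (1,…,1,0,…)` (`hilbert_jacobianIdeal_colon_eq_pointHF`).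
  Proof as printed: `⊇` because `F_{x_i} ≡ F_{x_i}(c,1)·x₁^{d−1} (mod x₀ − c x₁)` (`sub_C_eval_mul_X_pow_mem_span`),
  and both sides are Artinian Gorenstein of socle `d − 2` (`IsArtinianGorenstein.colon`,
  `isArtinianGorenstein_pointIdeal`), hence equal (`IsArtinianGorenstein.colon_eq_of_le`, IK Lemma 2.14).
* `exists_smul_of_mul_pointForm_mem`: such a `P` is UNIQUE up to a non-zero scalar (equal Gorenstein ideals ⇒
  proportional functionals `ℓ(·P)`, `ℓ(·P')`, DFV Rem. 2.1 / tree `annIdeal_eq_annIdeal_iff_exists_smul`; then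
  `P' − μP ∈ J^F` has degree `d − 2 < d − 1`), so the class `δ` of Thm. 7.1 is determined by the point `c`.
* DFV's quotient is exact: a form of degree `d − 1` vanishing at `(c:1)` is `P·(x₀ − c x₁)`
  (`exists_isHomogeneous_mul_pointForm_eq`); so `P` (`exists_dfvPolynomial`, numerator `dfvNumerator F c =
  a F_{x₀} − b F_{x₁}`) and the point polynomials `P_i` (`exists_pointPolynomial`, numerator
  `pointNumerator F r_i = r_i F_{x₀} + F_{x₁}`, which vanishes at a root by Euler) exist as polynomials.
* **Fakeness** (`ne_smul_of_mul_pointForm_mem`): for `d ≥ 3`, forms `P`, `P'` as above attached to two different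
  points `c ≠ c'` are never proportional — their Gorenstein ideals differ (`pointIdeal_injective`: substitute
  `x₀ ↦ c'x₁`), although both have the Hilbert function of a point. (For `d = 2` all of `S_0 = K` is one line and
  there is no fake class; the theorem needs `d ≥ 3`, implicit in print.)
* **The hypersurface of Thm. 7.1**, `F = splitForm r = ∏_i (x₀ − r_i x₁)` with `r : Fin d → K` injective and
  `d ≠ 0` in `K`: `J^F` is Artinian Gorenstein of socle `2(d − 2)` (`isArtinianGorenstein_jacobianIdeal_splitForm`:
  the partials have no common zero — Euler plus `F_{x₀}(r_i t, t) = t^{d−1}∏_{j≠i}(r_i − r_j)`,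
  `aeval_pderiv_zero_splitForm_of_root`); at EVERY `c ∈ K` a partial is non-zero
  (`eval_pderiv_splitForm_ne_zero`); DFV's `P` is non-zero for `c` not a root (`dfvNumerator_splitForm_ne_zero`:
  evaluate at two roots) and so is `P_i` (`pointNumerator_splitForm_ne_zero`); and the assembled statement
  **`zeroDimensional_fake_linear_cycle`**: (i) `(J^F : P) = ⟨x₀ − c x₁, x₀^{d−1}, x₁^{d−1}⟩`, (ii) `HF_δ = HF_{[p_i]}`,
  (iii) `P ∉ K·P_i` for every `i` — `δ` is a fake version of every point class.

Rationality ("`δ ∈ H⁰(X,ℚ)_prim`") is, at this level, the statement that `P` and the `P_i` have coefficients in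
the ground field, which is built in (`K = ℚ` in print); the printed transcendental step "the residue map is an
isomorphism `ℂ[x_0,x_1]_{d−2} = R^F_{d−2} ≃ H⁰(X,ℂ)_prim`" is not needed for (i)–(iii) and is not formalised.

## References

* [DuqueFrancoVillaflor2025Join] J. Duque Franco, R. Villaflor Loyola, Periods of join algebraic cycles,
  arXiv:2312.17222, Def. 7.1, Thm. 7.1 with proof, eqs. (eqPfake0dim), (eqPi); Def. 2.1–2.2; Ex. 6.1.
* [IarrobinoKanev1999] A. Iarrobino, V. Kanev, LNM 1721, Lemma 2.14 (tree `IsArtinianGorenstein.eq_of_le`).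
* [VoisinHodgeII2003] C. Voisin, Hodge Theory and Complex Algebraic Geometry II, Thm. 6.19 (Macaulay; tree
  `HodgeTheory.isArtinianGorenstein_jacobianIdeal_of_forall_aeval`).
-/

noncomputable section

open MvPolynomial Module
open Literature.RingTheory.MvPolynomial Literature.AlgebraicGeometry.Kloosterman2023
open Literature.AlgebraicGeometry.Kloosterman2025
open Literature.AlgebraicGeometry.HodgeTheory
open Literature.AlgebraicGeometry.Motives.UniversalHypersurface

attribute [local instance] MvPolynomial.gradedAlgebra

namespace Literature.AlgebraicGeometry.DuqueFrancoVillaflor2025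

universe u

variable {K : Type u} [Field K]

/-! ## The point `(c : 1)` of `ℙ¹`: its linear form, the substitution `x₀ ↦ c x₁`, its ideal -/

/-- The linear form `x₀ − c·x₁` of the point `(c : 1) ∈ ℙ¹` (DFV §7: the generator `x_0 − c x_1` of
`J^{F,δ}`). [cite: DuqueFrancoVillaflor2025Join, Theorem 7.1 (proof)] -/
def pointForm (c : K) : MvPolynomial (Fin 2) K := X 0 - C c * X 1

/-- Restriction to the line through `(c : 1)`: the substitution `x₀ ↦ c·x₁`, `x₁ ↦ x₁`.
[cite: DuqueFrancoVillaflor2025Join, Theorem 7.1 (proof)] -/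
def pointSubst (c : K) : MvPolynomial (Fin 2) K →ₐ[K] MvPolynomial (Fin 2) K :=
  aeval ![C c * X 1, X 1]

/-- **The ideal of the point `(c : 1)` on a binary form of degree `d`**:
`⟨x₀ − c x₁, x₁^{d−1}⟩ = ⟨x₀ − c x₁, x₀^{d−1}, x₁^{d−1}⟩` (DFV §7, proof of Thm. 7.1:
"`J^{F,δ} = (J^F : P) = ⟨x_0 − cx_1, x_0^{d−1}, x_1^{d−1}⟩`"; Rem. 7.1, eq. (eqAGfakelcFermat) with `n = 0`),
presented as the complete intersection of the two forms `x₀ − c x₁`, `x₁^{d−1}`.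
[cite: DuqueFrancoVillaflor2025Join, Theorem 7.1 (proof) and Remark 7.1] -/
def pointIdealGens (d : ℕ) (c : K) : Fin 2 → MvPolynomial (Fin 2) K := ![pointForm c, X 1 ^ (d - 1)]

/-- The ideal `⟨x₀ − c x₁, x₁^{d−1}⟩`. [cite: DuqueFrancoVillaflor2025Join, Theorem 7.1 (proof)] -/
def pointIdeal (d : ℕ) (c : K) : Ideal (MvPolynomial (Fin 2) K) := Ideal.span (Set.range (pointIdealGens d c))

/-- `x₀ − c x₁` is a linear form. [folklore] -/
private theorem isHomogeneous_pointForm (c : K) : (pointForm c).IsHomogeneous 1 := by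
  refine (isHomogeneous_X K 0).sub ?_
  simpa using (isHomogeneous_C (Fin 2) c).mul (isHomogeneous_X K 1)

/-- `x₀ ↦ c x₁`. [folklore] -/
private theorem pointSubst_X_zero (c : K) : pointSubst c (X 0) = C c * X 1 := by
  simp [pointSubst]

/-- `x₁ ↦ x₁`. [folklore] -/
private theorem pointSubst_X_one (c : K) : pointSubst c (X 1) = X 1 := by
  simp [pointSubst]

/-- `G − G(c x₁, x₁) ∈ ⟨x₀ − c x₁⟩` for every polynomial `G`. [folklore] -/
private theorem sub_pointSubst_mem_span (c : K) (G : MvPolynomial (Fin 2) K) :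
    G - pointSubst c G ∈ Ideal.span {pointForm c} := by
  rw [← Ideal.Quotient.eq, ← Ideal.Quotient.mkₐ_eq_mk K, ← AlgHom.comp_apply]
  congr 1
  refine MvPolynomial.algHom_ext fun i => ?_
  simp only [AlgHom.comp_apply, Ideal.Quotient.mkₐ_eq_mk]
  rw [Ideal.Quotient.eq]
  match i with
  | 0 =>
    rw [pointSubst_X_zero]
    exact Ideal.subset_span rfl
  | 1 =>
    rw [pointSubst_X_one, sub_self]
    exact zero_mem _

/-- On a form `G` of degree `e`: `G(c x₁, x₁) = G(c,1) · x₁^e`. [folklore] -/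
private theorem pointSubst_of_isHomogeneous (c : K) {G : MvPolynomial (Fin 2) K} {e : ℕ}
    (hG : G.IsHomogeneous e) : pointSubst c G = C (eval ![c, 1] G) * X 1 ^ e := by
  classical
  conv_lhs => rw [G.as_sum]
  conv_rhs => rw [G.as_sum]
  simp only [map_sum, Finset.sum_mul]
  refine Finset.sum_congr rfl fun m hm => ?_
  have hdeg : m 0 + m 1 = e := by
    have h := hG (mem_support_iff.mp hm)
    rw [Finsupp.weight_apply, Finsupp.sum_fintype _ _ (by simp)] at h
    simpa [Fin.sum_univ_two] using h
  rw [pointSubst, aeval_monomial, eval_monomial, Finsupp.prod_fintype _ _ (by simp),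
    Finsupp.prod_fintype _ _ (by simp)]
  simp only [Fin.prod_univ_two, Matrix.cons_val_zero, Matrix.cons_val_one, one_pow,
    mul_one, algebraMap_eq, mul_pow, ← C_pow, C_mul]
  rw [← hdeg, pow_add]
  ring

/-- `G − G(c,1)·x₁^e ∈ ⟨x₀ − c x₁⟩` for a form `G` of degree `e`. [folklore] -/
private theorem sub_C_eval_mul_X_pow_mem_span (c : K) {G : MvPolynomial (Fin 2) K} {e : ℕ}
    (hG : G.IsHomogeneous e) : G - C (eval ![c, 1] G) * X 1 ^ e ∈ Ideal.span {pointForm c} := by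
  rw [← pointSubst_of_isHomogeneous c hG]
  exact sub_pointSubst_mem_span c G

/-- `x₀^k − c^k x₁^k ∈ ⟨x₀ − c x₁⟩`. [folklore] -/
private theorem X_zero_pow_sub_mem_span (c : K) (k : ℕ) :
    (X 0 : MvPolynomial (Fin 2) K) ^ k - C (c ^ k) * X 1 ^ k ∈ Ideal.span {pointForm c} := by
  have h := sub_C_eval_mul_X_pow_mem_span c (isHomogeneous_X_pow (R := K) (0 : Fin 2) k)
  simpa [eval_X] using h

/-- `x₀ − c x₁ ∈ ⟨x₀ − c x₁, x₁^{d−1}⟩`. [folklore] -/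
private theorem pointForm_mem_pointIdeal (d : ℕ) (c : K) : pointForm c ∈ pointIdeal d c :=
  Ideal.subset_span ⟨0, rfl⟩

/-- `x₁^{d−1} ∈ ⟨x₀ − c x₁, x₁^{d−1}⟩`. [folklore] -/
private theorem X_one_pow_mem_pointIdeal (d : ℕ) (c : K) : (X 1 : MvPolynomial (Fin 2) K) ^ (d - 1) ∈ pointIdeal d c :=
  Ideal.subset_span ⟨1, rfl⟩

/-- `⟨x₀ − c x₁⟩ ⊆ ⟨x₀ − c x₁, x₁^{d−1}⟩`. [folklore] -/
private theorem span_pointForm_le_pointIdeal (d : ℕ) (c : K) : Ideal.span {pointForm c} ≤ pointIdeal d c :=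
  (Ideal.span_singleton_le_iff_mem _).mpr (pointForm_mem_pointIdeal d c)

/-- `x₀^{d−1} ∈ ⟨x₀ − c x₁, x₁^{d−1}⟩`: the printed third generator is redundant.
[cite: DuqueFrancoVillaflor2025Join, Theorem 7.1 (proof)] -/
theorem X_zero_pow_mem_pointIdeal (d : ℕ) (c : K) : (X 0 : MvPolynomial (Fin 2) K) ^ (d - 1) ∈ pointIdeal d c := by
  have h1 := span_pointForm_le_pointIdeal d c (X_zero_pow_sub_mem_span c (d - 1))
  have h2 : C (c ^ (d - 1)) * (X 1 : MvPolynomial (Fin 2) K) ^ (d - 1) ∈ pointIdeal d c :=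
    Ideal.mul_mem_left _ _ (X_one_pow_mem_pointIdeal d c)
  simpa using (pointIdeal d c).add_mem h1 h2

/-- The printed presentation: `⟨x₀ − c x₁, x₁^{d−1}⟩ = ⟨x₀ − c x₁, x₀^{d−1}, x₁^{d−1}⟩`.
[cite: DuqueFrancoVillaflor2025Join, Theorem 7.1 (proof)] -/
theorem pointIdeal_eq_span_three (d : ℕ) (c : K) :
    pointIdeal d c = Ideal.span {pointForm c, (X 0 : MvPolynomial (Fin 2) K) ^ (d - 1), X 1 ^ (d - 1)} := by
  refine le_antisymm (Ideal.span_le.mpr ?_) (Ideal.span_le.mpr ?_)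
  · rintro _ ⟨i, rfl⟩
    fin_cases i
    · exact Ideal.subset_span (by simp [pointIdealGens])
    · exact Ideal.subset_span (by simp [pointIdealGens])
  · rintro g (rfl | rfl | rfl)
    · exact pointForm_mem_pointIdeal d c
    · exact X_zero_pow_mem_pointIdeal d c
    · exact X_one_pow_mem_pointIdeal d c

/-- **`⟨x₀ − c x₁, x₁^{d−1}⟩` is Artinian Gorenstein of socle degree `d − 2`** (a complete intersection of
degrees `1`, `d − 1`), for `d ≥ 2`. [cite: DuqueFrancoVillaflor2025Join, Definition 2.1 and Remark 7.1] -/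
theorem isArtinianGorenstein_pointIdeal {d : ℕ} (hd : 2 ≤ d) (c : K) :
    IsArtinianGorenstein (pointIdeal d c) (d - 2) := by
  have h := isArtinianGorenstein_span_of_X_pow_mem (K := K) (pointIdealGens d c) ![1, d - 1]
    (fun i => by
      fin_cases i
      · exact isHomogeneous_pointForm c
      · exact isHomogeneous_X_pow (1 : Fin 2) (d - 1))
    (fun i => by
      fin_cases i
      · exact Nat.one_pos
      · show 0 < d - 1; omega) (N := d - 1) (by omega)
    (fun i => by
      fin_cases i
      · exact X_zero_pow_mem_pointIdeal d c
      · exact X_one_pow_mem_pointIdeal d c)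
  have hs : ∑ i : Fin 2, ((![1, d - 1] : Fin 2 → ℕ) i - 1) = d - 2 := by
    simp [Fin.sum_univ_two]; omega
  rw [hs] at h
  exact h

/-- **The Hilbert function of `⟨x₀ − c x₁, x₁^{d−1}⟩` is that of a point**: `1` in degrees `0, …, d − 2` and `0`
above (tree `pointHF d`; DFV Ex. 6.1 `φ`). [cite: DuqueFrancoVillaflor2025Join, Example 6.1 and Theorem 7.1 (proof)] -/
theorem hilbert_pointIdeal {d : ℕ} (hd : 2 ≤ d) (c : K) (t : ℕ) :
    finrank K (homogeneousSubmodule (Fin 2) K t) - finrank K (idealDegree (pointIdeal d c) t) = pointHF d t := by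
  have h := hilbert_span_eq_ciHilbert (K := K) (pointIdealGens d c) ![1, d - 1]
    (fun i => by
      fin_cases i
      · exact isHomogeneous_pointForm c
      · exact isHomogeneous_X_pow (1 : Fin 2) (d - 1))
    (fun i => by
      fin_cases i
      · exact Nat.one_pos
      · show 0 < d - 1; omega) (N := d - 1)
    (fun i => by
      fin_cases i
      · exact X_zero_pow_mem_pointIdeal d c
      · exact X_one_pow_mem_pointIdeal d c) t
  rw [pointIdeal, h, show List.ofFn (![1, d - 1] : Fin 2 → ℕ) = [1, d - 1] by simp [List.ofFn_succ],
    ciHilbert_one_cons, pointHF_eq_ciHilbert]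


/-! ## Forms of low degree are not in an ideal generated in higher degree -/

/-- The degree-`k` component of `G · h` vanishes for a form `G` of degree `e > k`. [folklore] -/
private theorem homogeneousComponent_mul_eq_zero_of_lt {σ : Type*} {G : MvPolynomial σ K} {e k : ℕ}
    (hG : G.IsHomogeneous e) (h : MvPolynomial σ K) (hk : k < e) : homogeneousComponent k (G * h) = 0 := by
  classical
  rw [← sum_homogeneousComponent h, Finset.mul_sum, map_sum]
  refine Finset.sum_eq_zero fun j _ => ?_
  rw [homogeneousComponent_of_mem (hG.mul (homogeneousComponent_isHomogeneous j h)), if_neg (by omega)]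

/-- A non-zero form of degree `k` does not lie in an ideal generated by forms of degree `e > k`
(e.g. a form of degree `d − 2` is not in the Jacobian ideal `J^F = ⟨F_{x₀}, F_{x₁}⟩`, generated in degree
`d − 1`). [folklore] -/
private theorem notMem_span_of_isHomogeneous_lt {σ : Type*} {m : ℕ} {G : Fin m → MvPolynomial σ K} {e : ℕ}
    (hG : ∀ i, (G i).IsHomogeneous e) {P : MvPolynomial σ K} {k : ℕ} (hP : P.IsHomogeneous k) (hk : k < e)
    (hP0 : P ≠ 0) : P ∉ Ideal.span (Set.range G) := by
  classical
  intro hmem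
  obtain ⟨h, hh⟩ := Ideal.mem_span_range_iff_exists_fun.mp hmem
  apply hP0
  have hPk : homogeneousComponent k P = P := by
    rw [homogeneousComponent_of_mem hP, if_pos rfl]
  rw [← hPk, ← hh, map_sum]
  refine Finset.sum_eq_zero fun i _ => ?_
  rw [mul_comm]
  exact homogeneousComponent_mul_eq_zero_of_lt (hG i) _ hk

/-! ## The colon ideal `(J^F : P)` of a binary form -/

section Colon

variable {d : ℕ} {F : MvPolynomial (Fin 2) K}

/-- The partials of a binary form of degree `d` are forms of degree `d − 1`. [folklore] -/
private theorem isHomogeneous_pderiv_of_isHomogeneous (hF : F.IsHomogeneous d) (i : Fin 2) :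
    (pderiv i F).IsHomogeneous (d - 1) :=
  hF.pderiv

/-- A non-zero form of degree `d − 2` is not in the Jacobian ideal of a form of degree `d ≥ 2`
(so DFV's `P ∈ R^F_{d−2}` is a genuine element of `S_{d−2}`). [cite: DuqueFrancoVillaflor2025Join, Theorem 7.1] -/
theorem notMem_jacobianIdeal_of_isHomogeneous (hF : F.IsHomogeneous d) (hd : 2 ≤ d) {P : MvPolynomial (Fin 2) K}
    (hP : P.IsHomogeneous (d - 2)) (hP0 : P ≠ 0) : P ∉ jacobianIdeal F :=
  notMem_span_of_isHomogeneous_lt (fun i => isHomogeneous_pderiv_of_isHomogeneous hF i) hP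
    (show d - 2 < d - 1 by omega) hP0

/-- **`x₁^{d−1} ∈ ⟨x₀ − c x₁⟩ + J^F` when a partial of `F` does not vanish at `(c : 1)`**: indeed
`F_{x_i} ≡ F_{x_i}(c,1) · x₁^{d−1} (mod x₀ − c x₁)`. [cite: DuqueFrancoVillaflor2025Join, Theorem 7.1 (proof)] -/
theorem X_one_pow_mem_span_sup_jacobianIdeal (hF : F.IsHomogeneous d) {c : K}
    (hc : eval ![c, 1] (pderiv 0 F) ≠ 0 ∨ eval ![c, 1] (pderiv 1 F) ≠ 0) :
    (X 1 : MvPolynomial (Fin 2) K) ^ (d - 1) ∈ Ideal.span {pointForm c} ⊔ jacobianIdeal F := by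
  -- pick a partial `G` with `G(c,1) ≠ 0`
  obtain ⟨i, hi⟩ : ∃ i : Fin 2, eval ![c, 1] (pderiv i F) ≠ 0 := by
    rcases hc with h | h
    · exact ⟨0, h⟩
    · exact ⟨1, h⟩
  set b : K := eval ![c, 1] (pderiv i F) with hb
  have h1 : pderiv i F - C b * X 1 ^ (d - 1) ∈ Ideal.span {pointForm c} ⊔ jacobianIdeal F :=
    Ideal.mem_sup_left (sub_C_eval_mul_X_pow_mem_span c (isHomogeneous_pderiv_of_isHomogeneous hF i))
  have h2 : pderiv i F ∈ Ideal.span {pointForm c} ⊔ jacobianIdeal F :=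
    Ideal.mem_sup_right (pderiv_mem_jacobianIdeal F i)
  have h3 : C b * X 1 ^ (d - 1) ∈ Ideal.span {pointForm c} ⊔ jacobianIdeal F := by
    simpa using Submodule.sub_mem _ h2 h1
  have h4 := Ideal.mul_mem_left _ (C b⁻¹) h3
  rwa [← mul_assoc, ← C_mul, inv_mul_cancel₀ hi, C_1, one_mul] at h4

/-- Hence `⟨x₀ − c x₁, x₁^{d−1}⟩ ⊆ ⟨x₀ − c x₁⟩ + J^F`. [cite: DuqueFrancoVillaflor2025Join, Theorem 7.1 (proof)] -/
theorem pointIdeal_le_span_sup_jacobianIdeal (hF : F.IsHomogeneous d) {c : K}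
    (hc : eval ![c, 1] (pderiv 0 F) ≠ 0 ∨ eval ![c, 1] (pderiv 1 F) ≠ 0) :
    pointIdeal d c ≤ Ideal.span {pointForm c} ⊔ jacobianIdeal F := by
  refine Ideal.span_le.mpr ?_
  rintro _ ⟨i, rfl⟩
  match i with
  | 0 => exact Ideal.mem_sup_left (Ideal.subset_span rfl)
  | 1 => exact X_one_pow_mem_span_sup_jacobianIdeal hF hc

/-- Conversely `⟨x₀ − c x₁⟩ + J^F ⊆ ⟨x₀ − c x₁, x₁^{d−1}⟩`: both partials are `≡ F_{x_i}(c,1) x₁^{d−1}`.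
[cite: DuqueFrancoVillaflor2025Join, Theorem 7.1 (proof)] -/
theorem span_sup_jacobianIdeal_le_pointIdeal (hF : F.IsHomogeneous d) (c : K) :
    Ideal.span {pointForm c} ⊔ jacobianIdeal F ≤ pointIdeal d c := by
  refine sup_le (span_pointForm_le_pointIdeal d c) (Ideal.span_le.mpr ?_)
  rintro _ ⟨i, rfl⟩
  have h1 := span_pointForm_le_pointIdeal d c
    (sub_C_eval_mul_X_pow_mem_span c (isHomogeneous_pderiv_of_isHomogeneous hF i))
  have h2 : C (eval ![c, 1] (pderiv i F)) * (X 1 : MvPolynomial (Fin 2) K) ^ (d - 1) ∈ pointIdeal d c :=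
    Ideal.mul_mem_left _ _ (X_one_pow_mem_pointIdeal d c)
  simpa using (pointIdeal d c).add_mem h1 h2

/-- `⟨x₀ − c x₁⟩ + J^F = ⟨x₀ − c x₁, x₁^{d−1}⟩` when a partial of `F` is non-zero at `(c : 1)`.
[cite: DuqueFrancoVillaflor2025Join, Theorem 7.1 (proof)] -/
theorem span_sup_jacobianIdeal_eq_pointIdeal (hF : F.IsHomogeneous d) {c : K}
    (hc : eval ![c, 1] (pderiv 0 F) ≠ 0 ∨ eval ![c, 1] (pderiv 1 F) ≠ 0) :
    Ideal.span {pointForm c} ⊔ jacobianIdeal F = pointIdeal d c :=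
  le_antisymm (span_sup_jacobianIdeal_le_pointIdeal hF c) (pointIdeal_le_span_sup_jacobianIdeal hF hc)

/-- If `P · (x₀ − c x₁) ∈ J^F` and a partial of `F` is non-zero at `(c:1)`, then `x₁^{d−1} · P ∈ J^F`.
[cite: DuqueFrancoVillaflor2025Join, Theorem 7.1 (proof)] -/
theorem X_one_pow_mul_mem_jacobianIdeal (hF : F.IsHomogeneous d) {c : K}
    (hc : eval ![c, 1] (pderiv 0 F) ≠ 0 ∨ eval ![c, 1] (pderiv 1 F) ≠ 0) {P : MvPolynomial (Fin 2) K}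
    (hP : P * pointForm c ∈ jacobianIdeal F) : X 1 ^ (d - 1) * P ∈ jacobianIdeal F := by
  obtain ⟨A, hA, B, hB, hAB⟩ := Submodule.mem_sup.mp (X_one_pow_mem_span_sup_jacobianIdeal hF hc)
  obtain ⟨q, rfl⟩ := Ideal.mem_span_singleton'.mp hA
  rw [← hAB, add_mul, mul_assoc, mul_comm (pointForm c) P]
  exact (jacobianIdeal F).add_mem (Ideal.mul_mem_left _ q hP) (Ideal.mul_mem_right _ _ hB)

/-- `⟨x₀ − c x₁, x₁^{d−1}⟩ ⊆ (J^F : P)` under the same hypotheses. [cite: DuqueFrancoVillaflor2025Join, Theorem 7.1 (proof)] -/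
theorem pointIdeal_le_colon (hF : F.IsHomogeneous d) {c : K}
    (hc : eval ![c, 1] (pderiv 0 F) ≠ 0 ∨ eval ![c, 1] (pderiv 1 F) ≠ 0) {P : MvPolynomial (Fin 2) K}
    (hP : P * pointForm c ∈ jacobianIdeal F) : pointIdeal d c ≤ (jacobianIdeal F).colon {P} := by
  refine Ideal.span_le.mpr ?_
  rintro _ ⟨i, rfl⟩
  rw [SetLike.mem_coe, Submodule.mem_colon_singleton, smul_eq_mul]
  match i with
  | 0 => simpa [pointIdealGens, mul_comm] using hP
  | 1 => simpa [pointIdealGens] using X_one_pow_mul_mem_jacobianIdeal hF hc hP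

/-- **Duque Franco–Villaflor, Thm. 7.1 (the displayed identity), for every binary form with Artinian
Gorenstein Jacobian ideal.** Let `F ∈ K[x₀,x₁]` be a form of degree `d ≥ 2` whose Jacobian ideal `J^F` is
Artinian Gorenstein of socle degree `2(d−2)` (every binary form without multiple roots:
`HodgeTheory.isArtinianGorenstein_jacobianIdeal_of_forall_aeval`), let `c ∈ K` be such that the partials of
`F` do not both vanish at `(c:1)` (automatic when `d·F(c,1) ≠ 0`, by Euler), and let `P ≠ 0` be a form of
degree `d − 2` with `P·(x₀ − c x₁) ∈ J^F` (DFV's `P = (a F_{x₀} − b F_{x₁})/(x₀ − c x₁)`, `a = F_{x₁}(c,1)`,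
`b = F_{x₀}(c,1)`). Then "`J^{F,δ} = (J^F : P) = ⟨x_0 − cx_1, x_0^{d−1}, x_1^{d−1}⟩`". Proof: both sides are
Artinian Gorenstein of socle `d − 2` and `⊇` holds. [cite: DuqueFrancoVillaflor2025Join, Theorem 7.1 (proof)] -/
theorem jacobianIdeal_colon_eq_pointIdeal (hd : 2 ≤ d) (hF : F.IsHomogeneous d)
    (hJ : IsArtinianGorenstein (jacobianIdeal F) (2 * (d - 2))) {c : K}
    (hc : eval ![c, 1] (pderiv 0 F) ≠ 0 ∨ eval ![c, 1] (pderiv 1 F) ≠ 0) {P : MvPolynomial (Fin 2) K}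
    (hPh : P.IsHomogeneous (d - 2)) (hP0 : P ≠ 0) (hP : P * pointForm c ∈ jacobianIdeal F) :
    (jacobianIdeal F).colon {P} = pointIdeal d c :=
  hJ.colon_eq_of_le hPh (by omega) (notMem_jacobianIdeal_of_isHomogeneous hF (by omega) hPh hP0)
    (isArtinianGorenstein_pointIdeal hd c) (pointIdeal_le_colon hF hc hP)

/-- … in the printed three-generator form `(J^F : P) = ⟨x₀ − c x₁, x₀^{d−1}, x₁^{d−1}⟩`.
[cite: DuqueFrancoVillaflor2025Join, Theorem 7.1 (proof)] -/
theorem jacobianIdeal_colon_eq_span_three (hd : 2 ≤ d) (hF : F.IsHomogeneous d)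
    (hJ : IsArtinianGorenstein (jacobianIdeal F) (2 * (d - 2))) {c : K}
    (hc : eval ![c, 1] (pderiv 0 F) ≠ 0 ∨ eval ![c, 1] (pderiv 1 F) ≠ 0) {P : MvPolynomial (Fin 2) K}
    (hPh : P.IsHomogeneous (d - 2)) (hP0 : P ≠ 0) (hP : P * pointForm c ∈ jacobianIdeal F) :
    (jacobianIdeal F).colon {P} =
      Ideal.span {pointForm c, (X 0 : MvPolynomial (Fin 2) K) ^ (d - 1), X 1 ^ (d - 1)} := by
  rw [jacobianIdeal_colon_eq_pointIdeal hd hF hJ hc hPh hP0 hP, pointIdeal_eq_span_three]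

/-- **"and so `HF_δ = HF_{[p_i]}`"**: the Hilbert function of `(J^F : P)` is that of a point, `1` in
degrees `0, …, d − 2` and `0` above (tree `pointHF d`). [cite: DuqueFrancoVillaflor2025Join, Theorem 7.1 (proof)] -/
theorem hilbert_jacobianIdeal_colon_eq_pointHF (hd : 2 ≤ d) (hF : F.IsHomogeneous d)
    (hJ : IsArtinianGorenstein (jacobianIdeal F) (2 * (d - 2))) {c : K}
    (hc : eval ![c, 1] (pderiv 0 F) ≠ 0 ∨ eval ![c, 1] (pderiv 1 F) ≠ 0) {P : MvPolynomial (Fin 2) K}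
    (hPh : P.IsHomogeneous (d - 2)) (hP0 : P ≠ 0) (hP : P * pointForm c ∈ jacobianIdeal F) (t : ℕ) :
    finrank K (homogeneousSubmodule (Fin 2) K t) - finrank K (idealDegree ((jacobianIdeal F).colon {P}) t) =
      pointHF d t := by
  rw [jacobianIdeal_colon_eq_pointIdeal hd hF hJ hc hPh hP0 hP, hilbert_pointIdeal hd c t]

/-- **Uniqueness of `P` up to a scalar.** For a point `c` as above, any two forms `P, P' ≠ 0` of degree `d − 2`
with `P·(x₀ − c x₁), P'·(x₀ − c x₁) ∈ J^F` are proportional: they have the same Gorenstein ideal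
`(J^F : P) = (J^F : P') = ⟨x₀ − c x₁, x₁^{d−1}⟩`, so the functionals `ℓ(·P)`, `ℓ(·P')` (`J^F = Ann ℓ`) are
proportional (Macaulay / DFV Rem. 2.1, tree `annIdeal_eq_annIdeal_iff_exists_smul`) and `P' − μP ∈ J^F` has degree
`d − 2`, hence vanishes. So the class `δ` of Thm. 7.1 is determined by `c` up to a scalar.
[cite: DuqueFrancoVillaflor2025Join, Remark 2.1 and Theorem 7.1] [cite: IarrobinoKanev1999, Lemma 2.12] -/
theorem exists_smul_of_mul_pointForm_mem (hd : 2 ≤ d) (hF : F.IsHomogeneous d)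
    (hJ : IsArtinianGorenstein (jacobianIdeal F) (2 * (d - 2))) {c : K}
    (hc : eval ![c, 1] (pderiv 0 F) ≠ 0 ∨ eval ![c, 1] (pderiv 1 F) ≠ 0) {P P' : MvPolynomial (Fin 2) K}
    (hPh : P.IsHomogeneous (d - 2)) (hP0 : P ≠ 0) (hP : P * pointForm c ∈ jacobianIdeal F)
    (hP'h : P'.IsHomogeneous (d - 2)) (hP'0 : P' ≠ 0) (hP' : P' * pointForm c ∈ jacobianIdeal F) :
    ∃ μ : K, μ ≠ 0 ∧ P' = μ • P := by
  classical
  obtain ⟨ℓ, hℓ, -, hJℓ⟩ := hJ.exists_eq_annIdeal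
  have h1 := jacobianIdeal_colon_eq_pointIdeal hd hF hJ hc hPh hP0 hP
  have h2 := jacobianIdeal_colon_eq_pointIdeal hd hF hJ hc hP'h hP'0 hP'
  rw [hJℓ, ← annIdeal_comp_mulRight] at h1 h2
  have heq : annIdeal (ℓ ∘ₗ LinearMap.mulRight K P) = annIdeal (ℓ ∘ₗ LinearMap.mulRight K P') :=
    h1.trans h2.symm
  have hes : d - 2 + (d - 2) = 2 * (d - 2) := by omega
  have hcP := comp_mulRight_homogeneousComponent hℓ hPh hes
  have hcP' := comp_mulRight_homogeneousComponent hℓ hP'h hes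
  have hne : ℓ ∘ₗ LinearMap.mulRight K P' ≠ 0 := by
    intro h0
    apply notMem_jacobianIdeal_of_isHomogeneous hF hd hP'h hP'0
    rw [hJℓ, ← annIdeal_comp_mulRight_eq_top_iff, annIdeal_eq_top_iff]
    exact h0
  obtain ⟨μ, hμ, hμeq⟩ := (annIdeal_eq_annIdeal_iff_exists_smul hcP hcP' hne).mp heq
  refine ⟨μ, hμ, ?_⟩
  -- `P' − μ P ∈ J^F` is a form of degree `d − 2`, hence zero
  have hmem : P' - μ • P ∈ jacobianIdeal F := by
    rw [hJℓ, mem_annIdeal_iff]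
    intro g
    have hg := LinearMap.congr_fun hμeq g
    simp only [LinearMap.coe_comp, Function.comp_apply, LinearMap.mulRight_apply, LinearMap.smul_apply,
      smul_eq_mul] at hg
    rw [sub_mul, smul_mul_assoc, map_sub, map_smul, smul_eq_mul, mul_comm P' g, mul_comm P g, hg, sub_self]
  by_contra hne'
  have hhom : (P' - μ • P).IsHomogeneous (d - 2) := by
    refine hP'h.sub ?_
    rw [smul_eq_C_mul]
    simpa using (isHomogeneous_C (Fin 2) μ).mul hPh
  exact notMem_jacobianIdeal_of_isHomogeneous hF hd hhom (sub_ne_zero.mpr hne') hmem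

end Colon


/-! ## Euler's identity at `(c : 1)` and the polynomial `P` of DFV Thm. 7.1 -/

section Euler

variable {d : ℕ} {F : MvPolynomial (Fin 2) K}

/-- **Euler at the point `(c:1)`**: `c·F_{x₀}(c,1) + F_{x₁}(c,1) = d·F(c,1)` for a binary form of degree `d`
(DFV, proof of Thm. 7.2: "`a + bc = d·F_i(c,1)`"). [cite: DuqueFrancoVillaflor2025Join, Theorem 7.2 (proof)] -/
theorem euler_eval_point (hF : F.IsHomogeneous d) (c : K) :
    c * eval ![c, 1] (pderiv 0 F) + eval ![c, 1] (pderiv 1 F) = d * eval ![c, 1] F := by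
  have h := congr_arg (eval ![c, 1]) hF.sum_X_mul_pderiv
  simp only [Fin.sum_univ_two, map_add, map_mul, eval_X, Matrix.cons_val_zero, Matrix.cons_val_one,
    one_mul, nsmul_eq_mul, map_natCast] at h
  exact h

/-- If `d·F(c,1) ≠ 0` then the partials of `F` do not both vanish at `(c:1)` — DFV's hypothesis
`c ∈ ℚ ∖ {r_1,…,r_d}` (so `F(c,1) ≠ 0`) in the form used by the colon-ideal computation.
[cite: DuqueFrancoVillaflor2025Join, Theorem 7.1] -/
theorem eval_pderiv_ne_zero_of_eval_ne_zero (hF : F.IsHomogeneous d) {c : K}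
    (hc : (d : K) * eval ![c, 1] F ≠ 0) :
    eval ![c, 1] (pderiv 0 F) ≠ 0 ∨ eval ![c, 1] (pderiv 1 F) ≠ 0 := by
  by_contra h
  push Not at h
  apply hc
  rw [← euler_eval_point hF c, h.1, h.2, mul_zero, add_zero]

/-- **Division by `x₀ − c x₁`**: a form `N` of degree `d − 1 ≥ 1` vanishing at `(c:1)` is `P·(x₀ − c x₁)` for a
form `P` of degree `d − 2` (DFV: "`P := (a F_{x₀} − b F_{x₁})/(x_0 − c x_1) ∈ R^F_{d−2}`").
[cite: DuqueFrancoVillaflor2025Join, Theorem 7.1] -/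
theorem exists_isHomogeneous_mul_pointForm_eq (hd : 2 ≤ d) {N : MvPolynomial (Fin 2) K}
    (hN : N.IsHomogeneous (d - 1)) {c : K} (hNc : eval ![c, 1] N = 0) :
    ∃ P : MvPolynomial (Fin 2) K, P.IsHomogeneous (d - 2) ∧ P * pointForm c = N := by
  have hmem : N ∈ Ideal.span {pointForm c} := by
    simpa [hNc] using sub_C_eval_mul_X_pow_mem_span c hN
  obtain ⟨q, hq⟩ := Ideal.mem_span_singleton'.mp hmem
  refine ⟨homogeneousComponent (d - 2) q, homogeneousComponent_isHomogeneous _ _, ?_⟩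
  have h1 := homogeneousComponent_mul_add_of_isHomogeneous (isHomogeneous_pointForm c) q (d - 2)
  rw [show d - 2 + 1 = d - 1 by omega, mul_comm (pointForm c) q, hq, homogeneousComponent_of_mem hN,
    if_pos rfl] at h1
  rw [mul_comm, ← h1]

/-- **DFV's numerator** `a·F_{x₀} − b·F_{x₁}` with `a = F_{x₁}(c,1)`, `b = F_{x₀}(c,1)`: a form of degree `d − 1`
in the Jacobian ideal vanishing at `(c : 1)`. [cite: DuqueFrancoVillaflor2025Join, Theorem 7.1, eq. (eqPfake0dim)] -/
def dfvNumerator (F : MvPolynomial (Fin 2) K) (c : K) : MvPolynomial (Fin 2) K :=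
  C (eval ![c, 1] (pderiv 1 F)) * pderiv 0 F - C (eval ![c, 1] (pderiv 0 F)) * pderiv 1 F

/-- The numerator lies in `J^F`. [cite: DuqueFrancoVillaflor2025Join, Theorem 7.1] -/
theorem dfvNumerator_mem_jacobianIdeal (F : MvPolynomial (Fin 2) K) (c : K) :
    dfvNumerator F c ∈ jacobianIdeal F :=
  (jacobianIdeal F).sub_mem (Ideal.mul_mem_left _ _ (pderiv_mem_jacobianIdeal F 0))
    (Ideal.mul_mem_left _ _ (pderiv_mem_jacobianIdeal F 1))

/-- The numerator is a form of degree `d − 1`. [cite: DuqueFrancoVillaflor2025Join, Theorem 7.1] -/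
theorem isHomogeneous_dfvNumerator (hF : F.IsHomogeneous d) (c : K) :
    (dfvNumerator F c).IsHomogeneous (d - 1) := by
  unfold dfvNumerator
  refine IsHomogeneous.sub ?_ ?_
  · simpa using (isHomogeneous_C (Fin 2) (eval ![c, 1] (pderiv 1 F))).mul
      (isHomogeneous_pderiv_of_isHomogeneous hF 0)
  · simpa using (isHomogeneous_C (Fin 2) (eval ![c, 1] (pderiv 0 F))).mul
      (isHomogeneous_pderiv_of_isHomogeneous hF 1)

/-- The numerator vanishes at `(c : 1)`: `a·b − b·a = 0`. [cite: DuqueFrancoVillaflor2025Join, Theorem 7.1] -/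
theorem eval_dfvNumerator (F : MvPolynomial (Fin 2) K) (c : K) : eval ![c, 1] (dfvNumerator F c) = 0 := by
  simp only [dfvNumerator, map_sub, map_mul, eval_C]
  ring

/-- **DFV's `P` exists as a polynomial**: there is a form `P` of degree `d − 2` with
`P·(x₀ − c x₁) = a F_{x₀} − b F_{x₁}` — eq. (eqPfake0dim), the quotient being exact.
[cite: DuqueFrancoVillaflor2025Join, Theorem 7.1, eq. (eqPfake0dim)] -/
theorem exists_dfvPolynomial (hd : 2 ≤ d) (hF : F.IsHomogeneous d) (c : K) :
    ∃ P : MvPolynomial (Fin 2) K, P.IsHomogeneous (d - 2) ∧ P * pointForm c = dfvNumerator F c :=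
  exists_isHomogeneous_mul_pointForm_eq hd (isHomogeneous_dfvNumerator hF c) (eval_dfvNumerator F c)

/-- Any such `P` has `P·(x₀ − c x₁) ∈ J^F`, and `P ≠ 0` iff the numerator is non-zero. [folklore] -/
private theorem mul_pointForm_mem_of_eq_dfvNumerator {c : K} {P : MvPolynomial (Fin 2) K}
    (hP : P * pointForm c = dfvNumerator F c) : P * pointForm c ∈ jacobianIdeal F := by
  rw [hP]; exact dfvNumerator_mem_jacobianIdeal F c

/-- `x₀ − c x₁ ≠ 0`. [folklore] -/
private theorem pointForm_ne_zero (c : K) : pointForm c ≠ 0 := by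
  intro h
  have := congr_arg (eval ![1 + c, 1]) h
  simp [pointForm] at this

/-- `P ≠ 0` iff `P·(x₀ − c x₁) ≠ 0`. [folklore] -/
private theorem ne_zero_iff_mul_pointForm_ne_zero (c : K) (P : MvPolynomial (Fin 2) K) :
    P ≠ 0 ↔ P * pointForm c ≠ 0 := by
  rw [Ne, Ne, mul_eq_zero, not_or]
  exact ⟨fun h => ⟨h, pointForm_ne_zero c⟩, fun h => h.1⟩

end Euler

/-! ## Different points give different ideals: the source of fakeness -/

section Injective

/-- For `d ≥ 3`, **`x₀ − c x₁ ∈ ⟨x₀ − c' x₁, x₁^{d−1}⟩` forces `c = c'`** (substitute `x₀ ↦ c' x₁`: the ideal goes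
to `⟨x₁^{d−1}⟩`, the form to `(c' − c)·x₁`, and `x₁ ∉ ⟨x₁^{d−1}⟩` as `d − 1 ≥ 2`): the Gorenstein ideals
`J^{F,[p]}` of two different points differ (DFV Rem. 2.1: `J^{F,λ₁} = J^{F,λ₂}` iff `λ₁`, `λ₂` are proportional).
[cite: DuqueFrancoVillaflor2025Join, Remark 2.1 and Definition 7.1] -/
theorem eq_of_pointForm_mem_pointIdeal {d : ℕ} (hd : 3 ≤ d) {c c' : K} (h : pointForm c ∈ pointIdeal d c') :
    c = c' := by
  -- push the membership through the substitution `x₀ ↦ c' x₁`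
  have hmap : pointSubst c' (pointForm c) ∈ Ideal.map (pointSubst c') (pointIdeal d c') :=
    Ideal.mem_map_of_mem _ h
  have hle : Ideal.map (pointSubst c') (pointIdeal d c') ≤
      Ideal.span (Set.range ![(X 1 : MvPolynomial (Fin 2) K) ^ (d - 1)]) := by
    rw [pointIdeal, Ideal.map_span]
    refine Ideal.span_le.mpr ?_
    rintro _ ⟨_, ⟨i, rfl⟩, rfl⟩
    match i with
    | 0 =>
      have : pointSubst c' (pointForm c') = 0 := by
        simp [pointForm, pointSubst_X_zero, pointSubst_X_one, map_sub, map_mul]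
      simp only [pointIdealGens, Matrix.cons_val_zero, this, SetLike.mem_coe]
      exact zero_mem _
    | 1 =>
      simp only [pointIdealGens, Matrix.cons_val_one, Matrix.cons_val_zero, map_pow, pointSubst_X_one,
        SetLike.mem_coe]
      exact Ideal.subset_span ⟨0, rfl⟩
  have himg : pointSubst c' (pointForm c) = C (c' - c) * X 1 := by
    simp only [pointForm, map_sub, map_mul, pointSubst_X_zero, pointSubst_X_one, MvPolynomial.algHom_C,
      algebraMap_eq]
    ring
  have hmem : C (c' - c) * (X 1 : MvPolynomial (Fin 2) K) ∈
      Ideal.span (Set.range ![(X 1 : MvPolynomial (Fin 2) K) ^ (d - 1)]) := by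
    rw [← himg]; exact hle hmap
  by_contra hne
  have hcc : c' - c ≠ 0 := sub_ne_zero.mpr (Ne.symm hne)
  have hX : (X 1 : MvPolynomial (Fin 2) K) ∈ Ideal.span (Set.range ![(X 1 : MvPolynomial (Fin 2) K) ^ (d - 1)]) := by
    have := Ideal.mul_mem_left _ (C (c' - c)⁻¹) hmem
    rwa [← mul_assoc, ← C_mul, inv_mul_cancel₀ hcc, C_1, one_mul] at this
  exact notMem_span_of_isHomogeneous_lt (e := d - 1) (fun i => by
      match i with
      | 0 => exact isHomogeneous_X_pow (1 : Fin 2) (d - 1))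
    (isHomogeneous_X K (1 : Fin 2)) (by omega) (X_ne_zero 1) hX

/-- **`c ↦ ⟨x₀ − c x₁, x₁^{d−1}⟩` is injective for `d ≥ 3`** (different points, different Gorenstein ideals).
[cite: DuqueFrancoVillaflor2025Join, Remark 2.1 and Definition 7.1] -/
theorem pointIdeal_injective {d : ℕ} (hd : 3 ≤ d) : Function.Injective (pointIdeal (K := K) d) :=
  fun c _ h => eq_of_pointForm_mem_pointIdeal hd (h ▸ pointForm_mem_pointIdeal d c)

end Injective


/-! ## Fake versus genuine: classes with the Hilbert function of a point attached to different points
are not proportional -/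

section Fake

variable {d : ℕ} {F : MvPolynomial (Fin 2) K}

/-- `(I : a·P) = (I : P)` for a non-zero scalar `a`. [folklore] -/
private theorem colon_singleton_smul (I : Ideal (MvPolynomial (Fin 2) K)) {a : K} (ha : a ≠ 0)
    (P : MvPolynomial (Fin 2) K) : I.colon {a • P} = I.colon {P} := by
  ext g
  rw [Submodule.mem_colon_singleton, Submodule.mem_colon_singleton, smul_eq_mul, smul_eq_mul,
    smul_eq_C_mul, mul_left_comm]
  exact Ideal.unit_mul_mem_iff_mem I ((isUnit_iff_ne_zero.mpr ha).map C)

/-- **Fakeness (DFV Def. 7.1: "`λ_prim` is not a scalar multiple of `[Z]_prim`") at the level of polynomials.**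
For `d ≥ 3`: if `P ≠ 0` and `P' ≠ 0` are forms of degree `d − 2` with `P·(x₀ − c x₁) ∈ J^F`,
`P'·(x₀ − c' x₁) ∈ J^F` for two points `c ≠ c'` at which the partials of `F` do not both vanish, then
`P` is not a scalar multiple of `P'` (their Gorenstein ideals `⟨x₀ − c x₁, x₁^{d−1}⟩ ≠ ⟨x₀ − c' x₁, x₁^{d−1}⟩`
differ, although both have the Hilbert function of a point).
[cite: DuqueFrancoVillaflor2025Join, Definition 7.1 and Theorem 7.1] -/
theorem ne_smul_of_mul_pointForm_mem (hd : 3 ≤ d) (hF : F.IsHomogeneous d)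
    (hJ : IsArtinianGorenstein (jacobianIdeal F) (2 * (d - 2))) {c c' : K} (hcc : c ≠ c')
    (hc : eval ![c, 1] (pderiv 0 F) ≠ 0 ∨ eval ![c, 1] (pderiv 1 F) ≠ 0)
    (hc' : eval ![c', 1] (pderiv 0 F) ≠ 0 ∨ eval ![c', 1] (pderiv 1 F) ≠ 0)
    {P P' : MvPolynomial (Fin 2) K} (hPh : P.IsHomogeneous (d - 2)) (hP0 : P ≠ 0)
    (hP : P * pointForm c ∈ jacobianIdeal F) (hP'h : P'.IsHomogeneous (d - 2)) (hP'0 : P' ≠ 0)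
    (hP' : P' * pointForm c' ∈ jacobianIdeal F) (μ : K) : P ≠ μ • P' := by
  intro h
  have hμ : μ ≠ 0 := by
    rintro rfl
    exact hP0 (by rw [h, zero_smul])
  have h1 := jacobianIdeal_colon_eq_pointIdeal (by omega) hF hJ hc hPh hP0 hP
  have h2 := jacobianIdeal_colon_eq_pointIdeal (by omega) hF hJ hc' hP'h hP'0 hP'
  rw [h, colon_singleton_smul _ hμ, h2] at h1
  exact hcc (pointIdeal_injective hd h1.symm)

end Fake

/-! ## The hypersurface `X = {(x₀ − r₁x₁)⋯(x₀ − r_d x₁) = 0} ⊂ ℙ¹` of Thm. 7.1 -/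

section Split

variable {d : ℕ}

/-- **The binary form `F = (x₀ − r₁x₁)(x₀ − r₂x₁)⋯(x₀ − r_d x₁)`** of DFV Thm. 7.1 (there with `r_i ∈ ℚ`
pairwise distinct; here over any field). [cite: DuqueFrancoVillaflor2025Join, Theorem 7.1] -/
def splitForm (r : Fin d → K) : MvPolynomial (Fin 2) K := ∏ i, pointForm (r i)

/-- `F` is a form of degree `d`. [cite: DuqueFrancoVillaflor2025Join, Theorem 7.1] -/
theorem isHomogeneous_splitForm (r : Fin d → K) : (splitForm r).IsHomogeneous d := by
  have h := IsHomogeneous.prod Finset.univ (fun i => pointForm (r i)) (fun _ => 1)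
    (fun i _ => isHomogeneous_pointForm (r i))
  simpa [splitForm] using h

/-- Values of `F`: `F(x) = ∏ (x₀ − r_i x₁)`. [cite: DuqueFrancoVillaflor2025Join, Theorem 7.1] -/
theorem aeval_splitForm {L : Type*} [CommRing L] [Algebra K L] (r : Fin d → K) (x : Fin 2 → L) :
    aeval x (splitForm r) = ∏ i, (x 0 - algebraMap K L (r i) * x 1) := by
  simp [splitForm, pointForm, map_prod]

/-- `F(c,1) = ∏ (c − r_i)`. [cite: DuqueFrancoVillaflor2025Join, Theorem 7.1] -/
theorem eval_splitForm (r : Fin d → K) (c : K) : eval ![c, 1] (splitForm r) = ∏ i, (c - r i) := by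
  simp [splitForm, pointForm, map_prod]

/-- `F(c,1) ≠ 0` iff `c` is not a root (`c ∈ K ∖ {r_1,…,r_d}`). [cite: DuqueFrancoVillaflor2025Join, Theorem 7.1] -/
theorem eval_splitForm_ne_zero_iff (r : Fin d → K) (c : K) : eval ![c, 1] (splitForm r) ≠ 0 ↔ ∀ i, c ≠ r i := by
  rw [eval_splitForm, Finset.prod_ne_zero_iff]
  simp [sub_ne_zero]

/-- `∂(x₀ − r x₁)/∂x₀ = 1`. [folklore] -/
private theorem pderiv_zero_pointForm (c : K) : pderiv 0 (pointForm c) = 1 := by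
  simp [pointForm, pderiv_X]

/-- **`F_{x₀}` at a point of the line `x₀ = r_i x₁`**: `F_{x₀}(r_i t, t) = t^{d−1}·∏_{j ≠ i}(r_i − r_j)` (product
rule: only the factor `∏_{j≠i}` survives) — the roots of the printed `X` are simple.
[cite: DuqueFrancoVillaflor2025Join, Theorem 7.1] -/
theorem aeval_pderiv_zero_splitForm_of_root {L : Type*} [CommRing L] [Algebra K L] (r : Fin d → K) (i : Fin d)
    {x : Fin 2 → L} (hx : x 0 = algebraMap K L (r i) * x 1) :
    aeval x (pderiv 0 (splitForm r)) = ∏ j ∈ Finset.univ.erase i, (algebraMap K L (r i) - algebraMap K L (r j)) * x 1 := by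
  have hsplit : splitForm r = pointForm (r i) * ∏ j ∈ Finset.univ.erase i, pointForm (r j) := by
    rw [splitForm, ← Finset.mul_prod_erase Finset.univ (fun j => pointForm (r j)) (Finset.mem_univ i)]
  have hzero : aeval x (pointForm (r i)) = 0 := by
    simp [pointForm, hx]
  rw [hsplit, (pderiv 0).leibniz, smul_eq_mul, smul_eq_mul, map_add, map_mul, map_mul, hzero, zero_mul,
    zero_add, pderiv_zero_pointForm, map_one, mul_one, map_prod]
  refine Finset.prod_congr rfl fun j _ => ?_
  simp only [pointForm, map_sub, map_mul, aeval_X, MvPolynomial.algHom_C, hx]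
  ring

/-- **`{F = 0} ⊂ ℙ¹` is smooth**: for pairwise distinct `r_i` and `d ≠ 0` in `K`, the partials `F_{x₀}, F_{x₁}` have no
common zero besides `0` (over any field extension). [cite: DuqueFrancoVillaflor2025Join, Theorem 7.1] -/
theorem eq_zero_of_aeval_pderiv_splitForm {L : Type*} [Field L] [Algebra K L] {r : Fin d → K}
    (hr : Function.Injective r) (hdK : (d : K) ≠ 0) (x : Fin 2 → L)
    (hx : ∀ i, aeval x (pderiv i (splitForm r)) = 0) : x = 0 := by
  -- Euler: `F(x) = 0`
  have hE := congr_arg (aeval x) (isHomogeneous_splitForm r).sum_X_mul_pderiv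
  simp only [Fin.sum_univ_two, map_add, map_mul, aeval_X, hx 0, hx 1, mul_zero, add_zero,
    nsmul_eq_mul, map_natCast] at hE
  have hdL : (d : L) ≠ 0 := by
    rw [← map_natCast (algebraMap K L)]
    exact (map_ne_zero_iff _ (algebraMap K L).injective).mpr hdK
  have hF0 : aeval x (splitForm r) = 0 := by
    rcases mul_eq_zero.mp hE.symm with h | h
    · exact absurd h hdL
    · exact h
  -- so `x` lies on a line `x₀ = r_i x₁`
  rw [aeval_splitForm, Finset.prod_eq_zero_iff] at hF0
  obtain ⟨i, -, hi⟩ := hF0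
  have hx0 : x 0 = algebraMap K L (r i) * x 1 := sub_eq_zero.mp hi
  -- and `F_{x₀}(x) = x₁^{d−1} ∏ (r_i − r_j) = 0` forces `x₁ = 0`
  have h0 := hx 0
  rw [aeval_pderiv_zero_splitForm_of_root r i hx0, Finset.prod_eq_zero_iff] at h0
  obtain ⟨j, hj, hj0⟩ := h0
  have hij : algebraMap K L (r i) - algebraMap K L (r j) ≠ 0 := by
    rw [sub_ne_zero, Ne, (algebraMap K L).injective.eq_iff]
    exact fun h => (Finset.ne_of_mem_erase hj) (hr h).symm
  have hx1 : x 1 = 0 := by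
    rcases mul_eq_zero.mp hj0 with h | h
    · exact absurd h hij
    · exact h
  funext k
  match k with
  | 0 => rw [hx0, hx1, mul_zero]; rfl
  | 1 => rw [hx1]; rfl

/-- **`J^F` is Artinian Gorenstein of socle degree `2(d−2)`** for `F = ∏(x₀ − r_i x₁)` with distinct `r_i`,
`d ≥ 2`, `d ≠ 0` in `K` (Macaulay; tree `HodgeTheory.isArtinianGorenstein_jacobianIdeal_of_forall_aeval`).
[cite: DuqueFrancoVillaflor2025Join, Theorem 7.1 (proof: "`J^{F}` is Artinian Gorenstein of socle in degree `2d−4`")] -/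
theorem isArtinianGorenstein_jacobianIdeal_splitForm {r : Fin d → K} (hr : Function.Injective r) (hd : 2 ≤ d)
    (hdK : (d : K) ≠ 0) : IsArtinianGorenstein (jacobianIdeal (splitForm r)) (2 * (d - 2)) := by
  have h := isArtinianGorenstein_jacobianIdeal_of_forall_aeval (AlgebraicClosure K) (isHomogeneous_splitForm r)
    hd (eq_zero_of_aeval_pderiv_splitForm (L := AlgebraicClosure K) hr hdK)
  simpa [two_mul] using h

/-- `F_{x₀}(r_i, 1) = ∏_{j≠i}(r_i − r_j) ≠ 0`: the roots are simple. [cite: DuqueFrancoVillaflor2025Join, Theorem 7.1] -/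
theorem eval_pderiv_zero_splitForm_root {r : Fin d → K} (hr : Function.Injective r) (i : Fin d) :
    eval ![r i, 1] (pderiv 0 (splitForm r)) ≠ 0 := by
  have h := aeval_pderiv_zero_splitForm_of_root (L := K) r i (x := ![r i, 1]) (by simp)
  have hne : ∏ j ∈ Finset.univ.erase i,
      (algebraMap K K (r i) - algebraMap K K (r j)) * (![r i, 1] : Fin 2 → K) 1 ≠ 0 := by
    rw [Finset.prod_ne_zero_iff]
    intro j hj
    have hij : r i - r j ≠ 0 := sub_ne_zero.mpr fun h' => (Finset.ne_of_mem_erase hj) (hr h').symm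
    simpa using hij
  rw [← h] at hne
  exact hne

/-- At a root: `F_{x₁}(r_i,1) = −r_i·F_{x₀}(r_i,1)` (Euler with `F(r_i,1) = 0`). [cite: DuqueFrancoVillaflor2025Join, Theorem 7.1 (proof)] -/
theorem eval_pderiv_one_splitForm_root (r : Fin d → K) (i : Fin d) :
    eval ![r i, 1] (pderiv 1 (splitForm r)) = -(r i * eval ![r i, 1] (pderiv 0 (splitForm r))) := by
  have hE := euler_eval_point (isHomogeneous_splitForm r) (r i)
  have hF0 : eval ![r i, 1] (splitForm r) = 0 := by
    rw [eval_splitForm]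
    exact Finset.prod_eq_zero (Finset.mem_univ i) (sub_self _)
  rw [hF0, mul_zero] at hE
  linear_combination hE

/-- At every point of `K`, root or not, the partials of `F = ∏(x₀ − r_i x₁)` (distinct `r_i`, `d ≠ 0` in `K`) do
not both vanish. [cite: DuqueFrancoVillaflor2025Join, Theorem 7.1] -/
theorem eval_pderiv_splitForm_ne_zero {r : Fin d → K} (hr : Function.Injective r) (hdK : (d : K) ≠ 0) (c : K) :
    eval ![c, 1] (pderiv 0 (splitForm r)) ≠ 0 ∨ eval ![c, 1] (pderiv 1 (splitForm r)) ≠ 0 := by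
  by_cases hc : ∃ i, c = r i
  · obtain ⟨i, rfl⟩ := hc
    exact Or.inl (eval_pderiv_zero_splitForm_root hr i)
  · push Not at hc
    exact eval_pderiv_ne_zero_of_eval_ne_zero (isHomogeneous_splitForm r)
      (mul_ne_zero hdK ((eval_splitForm_ne_zero_iff r c).mpr hc))

/-- The numerator `a F_{x₀} − b F_{x₁}` of DFV's `P` at a root `r_i`: `(a + b·r_i)·F_{x₀}(r_i,1)`. [folklore] -/
private theorem eval_dfvNumerator_splitForm_root (r : Fin d → K) (c : K) (i : Fin d) :
    eval ![r i, 1] (dfvNumerator (splitForm r) c) =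
      (eval ![c, 1] (pderiv 1 (splitForm r)) + eval ![c, 1] (pderiv 0 (splitForm r)) * r i) *
        eval ![r i, 1] (pderiv 0 (splitForm r)) := by
  simp only [dfvNumerator, map_sub, map_mul, eval_C, eval_pderiv_one_splitForm_root]
  ring

/-- **DFV's `P` is non-zero**: for `c` not a root, `a F_{x₀} − b F_{x₁} ≠ 0` (evaluate at two distinct roots and
use Euler at `(c:1)`: `a + c·b = d·F(c,1) ≠ 0`). [cite: DuqueFrancoVillaflor2025Join, Theorem 7.1] -/
theorem dfvNumerator_splitForm_ne_zero {r : Fin d → K} (hr : Function.Injective r) (hd : 2 ≤ d)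
    (hdK : (d : K) ≠ 0) {c : K} (hc : ∀ i, c ≠ r i) : dfvNumerator (splitForm r) c ≠ 0 := by
  intro hN
  set a : K := eval ![c, 1] (pderiv 1 (splitForm r)) with ha_def
  set b : K := eval ![c, 1] (pderiv 0 (splitForm r)) with hb_def
  have hroot : ∀ i, a + b * r i = 0 := by
    intro i
    have h := eval_dfvNumerator_splitForm_root r c i
    rw [hN, map_zero] at h
    rcases mul_eq_zero.mp h.symm with h1 | h1
    · exact h1
    · exact absurd h1 (eval_pderiv_zero_splitForm_root hr i)
  have h0 := hroot ⟨0, by omega⟩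
  have h1 := hroot ⟨1, by omega⟩
  have hr01 : r ⟨0, by omega⟩ ≠ r ⟨1, by omega⟩ := by
    intro h
    have := hr h
    simp [Fin.ext_iff] at this
  have hb : b = 0 := by
    have : b * (r ⟨0, by omega⟩ - r ⟨1, by omega⟩) = 0 := by linear_combination h0 - h1
    rcases mul_eq_zero.mp this with h | h
    · exact h
    · exact absurd (sub_eq_zero.mp h) hr01
  have ha : a = 0 := by simpa [hb] using h0
  have hE := euler_eval_point (isHomogeneous_splitForm r) c
  have hFc : (d : K) * eval ![c, 1] (splitForm r) ≠ 0 :=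
    mul_ne_zero hdK ((eval_splitForm_ne_zero_iff r c).mpr hc)
  apply hFc
  rw [← hE, ← ha_def, ← hb_def, ha, hb, mul_zero, add_zero]

/-- **DFV eq. (eqPi): the numerator `r_i F_{x₀} + F_{x₁}` of the polynomial `P_i` of the point `p_i = (r_i : 1)`.**
[cite: DuqueFrancoVillaflor2025Join, Theorem 7.1 (proof), eq. (eqPi)] -/
def pointNumerator (F : MvPolynomial (Fin 2) K) (ρ : K) : MvPolynomial (Fin 2) K := C ρ * pderiv 0 F + pderiv 1 F

/-- `r F_{x₀} + F_{x₁} ∈ J^F`. [cite: DuqueFrancoVillaflor2025Join, Theorem 7.1 (proof)] -/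
theorem pointNumerator_mem_jacobianIdeal (F : MvPolynomial (Fin 2) K) (ρ : K) :
    pointNumerator F ρ ∈ jacobianIdeal F :=
  (jacobianIdeal F).add_mem (Ideal.mul_mem_left _ _ (pderiv_mem_jacobianIdeal F 0)) (pderiv_mem_jacobianIdeal F 1)

/-- `r F_{x₀} + F_{x₁}` is a form of degree `d − 1`. [cite: DuqueFrancoVillaflor2025Join, Theorem 7.1 (proof)] -/
theorem isHomogeneous_pointNumerator {F : MvPolynomial (Fin 2) K} (hF : F.IsHomogeneous d) (ρ : K) :
    (pointNumerator F ρ).IsHomogeneous (d - 1) := by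
  unfold pointNumerator
  refine IsHomogeneous.add ?_ (isHomogeneous_pderiv_of_isHomogeneous hF 1)
  simpa using (isHomogeneous_C (Fin 2) ρ).mul (isHomogeneous_pderiv_of_isHomogeneous hF 0)

/-- At `(ρ : 1)`: `(ρ F_{x₀} + F_{x₁})(ρ,1) = d·F(ρ,1)` (Euler), so it vanishes at a root.
[cite: DuqueFrancoVillaflor2025Join, Theorem 7.1 (proof)] -/
theorem eval_pointNumerator {F : MvPolynomial (Fin 2) K} (hF : F.IsHomogeneous d) (ρ : K) :
    eval ![ρ, 1] (pointNumerator F ρ) = d * eval ![ρ, 1] F := by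
  rw [← euler_eval_point hF ρ]
  simp [pointNumerator]

/-- **`P_i` exists as a polynomial**: at a root `ρ` of `F` there is a form `Q` of degree `d − 2` with
`Q·(x₀ − ρ x₁) = ρ F_{x₀} + F_{x₁}` (eq. (eqPi): `P_i = (r_i F_{x₀} + F_{x₁})/(x₀ − r_i x₁) ∈ ℚ[x₀,x₁]_{d−2}`).
[cite: DuqueFrancoVillaflor2025Join, Theorem 7.1 (proof), eq. (eqPi)] -/
theorem exists_pointPolynomial (hd : 2 ≤ d) {F : MvPolynomial (Fin 2) K} (hF : F.IsHomogeneous d) {ρ : K}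
    (hρ : eval ![ρ, 1] F = 0) :
    ∃ Q : MvPolynomial (Fin 2) K, Q.IsHomogeneous (d - 2) ∧ Q * pointForm ρ = pointNumerator F ρ :=
  exists_isHomogeneous_mul_pointForm_eq hd (isHomogeneous_pointNumerator hF ρ)
    (by rw [eval_pointNumerator hF, hρ, mul_zero])

/-- `r_i` is a root of `F = ∏(x₀ − r_j x₁)` (`p_i = (r_i : 1) ∈ X`). [cite: DuqueFrancoVillaflor2025Join, Theorem 7.1 (proof)] -/
theorem eval_splitForm_root (r : Fin d → K) (i : Fin d) : eval ![r i, 1] (splitForm r) = 0 := by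
  rw [eval_splitForm]
  exact Finset.prod_eq_zero (Finset.mem_univ i) (sub_self _)

/-- `r_i F_{x₀} + F_{x₁} ≠ 0` for `F = ∏(x₀ − r_j x₁)` with at least two distinct roots (evaluate at another root
`r_k`: `(r_i − r_k)·F_{x₀}(r_k,1) ≠ 0`). [cite: DuqueFrancoVillaflor2025Join, Theorem 7.1 (proof)] -/
theorem pointNumerator_splitForm_ne_zero {r : Fin d → K} (hr : Function.Injective r) (hd : 2 ≤ d) (i : Fin d) :
    pointNumerator (splitForm r) (r i) ≠ 0 := by
  -- another root `r_k`, `k ≠ i`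
  obtain ⟨k, hk⟩ : ∃ k : Fin d, k ≠ i := by
    by_cases hi : (i : ℕ) = 0
    · exact ⟨⟨1, by omega⟩, fun h => by simp [Fin.ext_iff, hi] at h⟩
    · exact ⟨⟨0, by omega⟩, fun h => by simp [Fin.ext_iff] at h; omega⟩
  intro hN
  have h := congr_arg (eval ![r k, 1]) hN
  simp only [pointNumerator, map_add, map_mul, eval_C, map_zero, eval_pderiv_one_splitForm_root] at h
  have h' : (r i - r k) * eval ![r k, 1] (pderiv 0 (splitForm r)) = 0 := by linear_combination h
  rcases mul_eq_zero.mp h' with h1 | h1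
  · exact hk (hr (sub_eq_zero.mp h1)).symm
  · exact eval_pderiv_zero_splitForm_root hr k h1

/-! ### Theorem 7.1 assembled -/

/-- **DFV Thm. 7.1 / Ex. 6.1 for `F = ∏(x₀ − r_i x₁)`, the colon ideal at every point `c ∈ K`**: for distinct
`r_i`, `d ≥ 2`, `d ≠ 0` in `K`, every `c ∈ K` (a root or not) and every form `P ≠ 0` of degree `d − 2` with
`P·(x₀ − c x₁) ∈ J^F`: `(J^F : P) = ⟨x₀ − c x₁, x₁^{d−1}⟩`. [cite: DuqueFrancoVillaflor2025Join, Theorem 7.1] -/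
theorem splitForm_colon_eq_pointIdeal {r : Fin d → K} (hr : Function.Injective r) (hd : 2 ≤ d)
    (hdK : (d : K) ≠ 0) (c : K) {P : MvPolynomial (Fin 2) K} (hPh : P.IsHomogeneous (d - 2)) (hP0 : P ≠ 0)
    (hP : P * pointForm c ∈ jacobianIdeal (splitForm r)) :
    (jacobianIdeal (splitForm r)).colon {P} = pointIdeal d c :=
  jacobianIdeal_colon_eq_pointIdeal hd (isHomogeneous_splitForm r)
    (isArtinianGorenstein_jacobianIdeal_splitForm hr hd hdK) (eval_pderiv_splitForm_ne_zero hr hdK c) hPh hP0 hP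

/-- … and its Hilbert function is that of a point ("`HF_δ = HF_{[p_i]}`"). [cite: DuqueFrancoVillaflor2025Join, Theorem 7.1] -/
theorem splitForm_hilbert_colon_eq_pointHF {r : Fin d → K} (hr : Function.Injective r) (hd : 2 ≤ d)
    (hdK : (d : K) ≠ 0) (c : K) {P : MvPolynomial (Fin 2) K} (hPh : P.IsHomogeneous (d - 2)) (hP0 : P ≠ 0)
    (hP : P * pointForm c ∈ jacobianIdeal (splitForm r)) (t : ℕ) :
    finrank K (homogeneousSubmodule (Fin 2) K t) -
        finrank K (idealDegree ((jacobianIdeal (splitForm r)).colon {P}) t) = pointHF d t := by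
  rw [splitForm_colon_eq_pointIdeal hr hd hdK c hPh hP0 hP, hilbert_pointIdeal hd c t]

/-- **DFV's `P` for `F = ∏(x₀ − r_i x₁)` and `c` not a root**: a NON-ZERO form of degree `d − 2` with
`P·(x₀ − c x₁) = a F_{x₀} − b F_{x₁} ∈ J^F`. [cite: DuqueFrancoVillaflor2025Join, Theorem 7.1, eq. (eqPfake0dim)] -/
theorem exists_dfvPolynomial_splitForm {r : Fin d → K} (hr : Function.Injective r) (hd : 2 ≤ d)
    (hdK : (d : K) ≠ 0) {c : K} (hc : ∀ i, c ≠ r i) :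
    ∃ P : MvPolynomial (Fin 2) K, P.IsHomogeneous (d - 2) ∧ P ≠ 0 ∧
      P * pointForm c = dfvNumerator (splitForm r) c ∧ P * pointForm c ∈ jacobianIdeal (splitForm r) := by
  obtain ⟨P, hPh, hP⟩ := exists_dfvPolynomial hd (isHomogeneous_splitForm r) c
  refine ⟨P, hPh, ?_, hP, mul_pointForm_mem_of_eq_dfvNumerator hP⟩
  rw [ne_zero_iff_mul_pointForm_ne_zero c, hP]
  exact dfvNumerator_splitForm_ne_zero hr hd hdK hc

/-- **The polynomial `P_i` of the point class `[p_i]`, `p_i = (r_i : 1)`**: a NON-ZERO form of degree `d − 2` with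
`P_i·(x₀ − r_i x₁) = r_i F_{x₀} + F_{x₁} ∈ J^F`. [cite: DuqueFrancoVillaflor2025Join, Theorem 7.1 (proof), eq. (eqPi)] -/
theorem exists_pointPolynomial_splitForm {r : Fin d → K} (hr : Function.Injective r) (hd : 2 ≤ d) (i : Fin d) :
    ∃ Q : MvPolynomial (Fin 2) K, Q.IsHomogeneous (d - 2) ∧ Q ≠ 0 ∧
      Q * pointForm (r i) = pointNumerator (splitForm r) (r i) ∧
        Q * pointForm (r i) ∈ jacobianIdeal (splitForm r) := by
  obtain ⟨Q, hQh, hQ⟩ := exists_pointPolynomial hd (isHomogeneous_splitForm r) (eval_splitForm_root r i)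
  refine ⟨Q, hQh, ?_, hQ, by rw [hQ]; exact pointNumerator_mem_jacobianIdeal _ _⟩
  rw [ne_zero_iff_mul_pointForm_ne_zero (r i), hQ]
  exact pointNumerator_splitForm_ne_zero hr hd i

/-- **Duque Franco–Villaflor, Theorem 7.1 (algebraic core): `δ` is a `0`-dimensional fake linear cycle.** Let
`F = (x₀ − r₁x₁)⋯(x₀ − r_d x₁)` with pairwise distinct `r_i ∈ K`, `d ≥ 3`, `d ≠ 0` in `K`, and let
`c ∈ K ∖ {r₁, …, r_d}`. For every form `P ≠ 0` of degree `d − 2` with `P·(x₀ − c x₁) ∈ J^F` (DFV's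
`P = (a F_{x₀} − b F_{x₁})/(x₀ − c x₁)`, which exists and is non-zero: `exists_dfvPolynomial_splitForm`) and every
polynomial `Q ≠ 0` of a point class `[p_i]` (`Q·(x₀ − r_i x₁) ∈ J^F`, e.g. `P_i` of eq. (eqPi),
`exists_pointPolynomial_splitForm`): (i) "`J^{F,δ} = (J^F : P) = ⟨x_0 − cx_1, x_0^{d−1}, x_1^{d−1}⟩`";
(ii) "`HF_δ = HF_{[p_i]}`" — both colon ideals have the Hilbert function of a point; (iii) `δ` is FAKE:
`P` is not a scalar multiple of `Q` (Def. 7.1: `λ_prim ∉ K·[Z]_prim`). In print `K = ℚ` and the rationality of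
`δ = q₁[p₁]_prim + ⋯ + q_d[p_d]_prim` comes from `P, P_i ∈ ℚ[x₀,x₁]_{d−2}`; the residue/primitive-cohomology
dictionary `P ↦ res(P·Ω/F)` is not formalised (cited). [cite: DuqueFrancoVillaflor2025Join, Theorem 7.1 and Definition 7.1] -/
theorem zeroDimensional_fake_linear_cycle {r : Fin d → K} (hr : Function.Injective r) (hd : 3 ≤ d)
    (hdK : (d : K) ≠ 0) {c : K} (hc : ∀ i, c ≠ r i) {P : MvPolynomial (Fin 2) K}
    (hPh : P.IsHomogeneous (d - 2)) (hP0 : P ≠ 0) (hP : P * pointForm c ∈ jacobianIdeal (splitForm r))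
    (i : Fin d) {Q : MvPolynomial (Fin 2) K} (hQh : Q.IsHomogeneous (d - 2)) (hQ0 : Q ≠ 0)
    (hQ : Q * pointForm (r i) ∈ jacobianIdeal (splitForm r)) :
    (jacobianIdeal (splitForm r)).colon {P} =
        Ideal.span {pointForm c, (X 0 : MvPolynomial (Fin 2) K) ^ (d - 1), X 1 ^ (d - 1)} ∧
      (∀ t, finrank K (homogeneousSubmodule (Fin 2) K t) -
          finrank K (idealDegree ((jacobianIdeal (splitForm r)).colon {P}) t) =
        finrank K (homogeneousSubmodule (Fin 2) K t) -
          finrank K (idealDegree ((jacobianIdeal (splitForm r)).colon {Q}) t)) ∧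
      ∀ μ : K, P ≠ μ • Q := by
  have hd2 : 2 ≤ d := by omega
  refine ⟨?_, fun t => ?_, fun μ => ?_⟩
  · rw [splitForm_colon_eq_pointIdeal hr hd2 hdK c hPh hP0 hP, pointIdeal_eq_span_three]
  · rw [splitForm_hilbert_colon_eq_pointHF hr hd2 hdK c hPh hP0 hP t,
      splitForm_hilbert_colon_eq_pointHF hr hd2 hdK (r i) hQh hQ0 hQ t]
  · exact ne_smul_of_mul_pointForm_mem hd (isHomogeneous_splitForm r)
      (isArtinianGorenstein_jacobianIdeal_splitForm hr hd2 hdK) (hc i) (eval_pderiv_splitForm_ne_zero hr hdK c)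
      (eval_pderiv_splitForm_ne_zero hr hdK (r i)) hPh hP0 hP hQh hQ0 hQ μ

end Split

end Literature.AlgebraicGeometry.DuqueFrancoVillaflor2025

end
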